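/-
Copyright (c) 2026 the pub-hodgecm-mathlib formalisation cell (harness21).  Prover seat hodgecm-mathlib-K2E4-p07 (g4) (road (d-w) of ‹J3› v2, owner K2E3-p03 (g3);
(C2b-i) «TOP INDEX», FILE C = the payer): `[S : S ∩ K_an] = (q+1)·q^{d−2}` at a wild ramified anisotropic plane — K2E5-p07 (g3)'s cand `sig_K2E3WildAnisoTopIndex` VERBATIM.  2026-09-04.
-/
import Summits.HodgeConjecture.HodgeConjecture.Theorems.K2E3WildQuaternionUnitIndex        -- ★ FILE B2 (this seat): `relIndex_normOne_eq` (`[D¹ : Λ¹] = (q+1)·q^{d−2}`), `exists_normOneGroups`; brings ★ FILE A∕B1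
import Summits.HodgeConjecture.HodgeConjecture.Theorems.K2E3WildAnisotropicPlaneIndex       -- ★ (K2E5-p16 (g3)): `exists_isRamifiedQuadraticDatum_of_hd` (the datum in the `hd` currency); brings ★ `K2E3WildAnisotropicPlaneNonIntegral` CM dress tools
import Literature.NumberTheory.Automorphic.UnitaryGroupIntegralPointsReductionRamified     -- ★ `natCard_residueField_eq_of_ramified` (`#𝓀[L_w] = #(𝓞_{L⁺}∕v)` at a ramified place)
import Literature.NumberTheory.Automorphic.ValuedFieldValuativeRelBridge                   -- ★ `natCard_residueField_eq_of_compatible`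
import Literature.NumberTheory.Weil1982.UnitaryFinTopFormLieGramWildLieSide                -- the cand's own import (currency of the (C2) closer ★ p857155)
import HarnessLib

/-!
# K2 ∕ E3, road (d-w) — (C2b-i) «TOP INDEX AT A WILD ANISOTROPIC PLANE»: `[S : S ∩ K_an] = (q+1)·q^{d−2}` (the payer of K2E5-p07 (g3)'s cand `sig_K2E3WildAnisoTopIndex`, = ★ p857155's `hTop`)

Cell `hodgecm-mathlib` (Track B «K2-LIT»), item h413 = `stmt-HodgeConjecture-24833`, route of record `route-HodgeConjecture-HCCMUnconditional`; PROOF lane (theorems only), `--supports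
stmt-HodgeConjecture-24833 --as helper`; count-neutral.  For the determinant-one subgroup `S` of `U_an = U(⟨1,−ξ⟩)(L⁺_v)` (membership read in the one-place model ★ `localNonsplitEquiv`) and
`K_an = cmLocalIntegralLevel L 2 ⟨1,−ξ⟩ v`, at a non-split ramified DYADIC place `w ∣ v` with different exponent `d` ((L)-kit binder `hd`) and `ξ` the W1 unit non-norm:
**`wildAnisoTopIndex`: `(S ⊓ K_an).relIndex S = (#(𝓞_{L⁺}∕v) + 1)·#(𝓞_{L⁺}∕v)^{d−2}`** — TOKEN FOR TOKEN the cand (sha16 of the cand file as dealt by K2E3-plan (g3) (D50); road-owner correction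
K2E3-p03 (g3) 03:36:02Z of the closed form; numerics `d ∈ {2,3,4}`: `3 ∕ 6 ∕ 12` at `q = 2`).
PROOF = CM DRESS of ★ FILE B2 `relIndex_normOne_eq` (`[D¹ : Λ¹] = (q+1)·q^{d−2}` over one complete field): the datum at `w` in the `hd` currency (★ `exists_isRamifiedQuadraticDatum_of_hd`), `|2|_w < 1`
(★ `valued_two_lt_one_of_two_mem`), `σ_w ξ_w = ξ_w` (★ `galAdicCompletionMap_algebraMap_of_complexConj_eq`); the injective hom `E = subtype ∘ localNonsplitEquiv : U_an(L⁺_v) → GL₂(L_w)` maps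
`S ↦ D¹ = {q(a,b) : N a − ξ_w N b = 1}` (★ Rogawski dictionary `mem_unitaryGroupOfForm_and_det_eq_one_iff`, ★ `placeForm_anisoPlane`) and `S ∩ K_an ↦ Λ¹` (★ `mem_localIntegralLevel_iff_of_smul_eq`,
★ `mem_glInt_iff_forall_v_le_one_and_v_det_eq_one`); `Subgroup.relIndex_map_map_of_injective`; `#𝓀[L_w] = #(𝓞_{L⁺}∕v)` (★ `natCard_residueField_eq_of_ramified`, `f(w|v) = 1`).
[cite: Kottwitz1988, §2 Thm. 2] [cite: Serre1979, Ch. IV §2 Prop. 6; Ch. V §3 Cor. 3] [cite: VignerasLNM800, Ch. II §4] [cite: Rogawski1990, §3.8 p. 33]  HONEST LABEL: HC_CM is proved only modulo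
the 7 printed citations (2 remaining named inputs: hLiu418 = stmt-HodgeConjecture-24832, h413 = stmt-HodgeConjecture-24833) until rung 0 closes; (W3)∕(C2) NOT proved here; count-neutral.

## References
* [Kottwitz1988] R. Kottwitz, *Tamagawa numbers* (1988) — §2.  * [Serre1979] J.-P. Serre, *Local Fields* (1979) — Ch. IV §2, Ch. V §3.  * [VignerasLNM800] M.-F. Vignéras, LNM 800 (1980) — Ch. II §4.
* [Rogawski1990] J. Rogawski, Ann. of Math. Stud. 123 (1990) — §3.8.
-/

set_option autoImplicit false
set_option linter.dupNamespace false

noncomputable section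

namespace Summit.HodgeConjecture.HodgeConjecture.Cruxes.H413.K2E3WildAnisotropicPlaneTopIndex

open WithZero NumberField IsDedekindDomain MeasureTheory
open scoped Valued Matrix MatrixGroups NNReal
open Literature.NumberTheory.Automorphic Literature.NumberTheory.Automorphic.UnitaryGroup Literature.NumberTheory.Rogawski1990
open Literature.NumberTheory.Weil1982.UnitaryFinTopForm
open Literature.NumberTheory.Automorphic.UnitaryThreeFourFrame (IsRamifiedQuadraticDatum)
open Literature.NumberTheory.Automorphic.HermitianLatticeTree (mem_glInt_iff_forall_v_le_one_and_v_det_eq_one)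
open Summit.HodgeConjecture.HodgeConjecture.Cruxes.H413.K2E3WildAnisotropicPlaneNonIntegral (valued_two_lt_one_of_two_mem galAdicCompletionMap_algebraMap_of_complexConj_eq)
open Summit.HodgeConjecture.HodgeConjecture.Cruxes.H413.K2E3WildAnisotropicPlaneIndex (exists_isRamifiedQuadraticDatum_of_hd)
open Summit.HodgeConjecture.HodgeConjecture.Cruxes.H413.K2E3WildQuaternionUnitIndex (exists_normOneGroups relIndex_normOne_eq)

/-- **(C2b-i) «TOP INDEX AT A WILD ANISOTROPIC PLANE»** — K2E5-p07 (g3)'s cand `sig_K2E3WildAnisoTopIndex` TOKEN FOR TOKEN (= the hypothesis `hTop` of ★ p857155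
`anCount_of_struct_of_topIndex_of_ladder`): at a non-split ramified dyadic place `w ∣ v` of the CM field `L` with different exponent `d`, for the W1 unit non-norm `ξ` and the
determinant-one subgroup `S` of `U(⟨1,−ξ⟩)(L⁺_v)`, `[S : S ∩ K_an] = (q_v + 1)·q_v^{d−2}` — the number of `U_an`-translates of `𝒪_w²`, i.e. `[D¹ : Λ¹]` of the quaternion division algebra
`(L_w∕L⁺_v, ξ)` against its unitary order `Λ = 𝒪_w ⊕ 𝒪_w j` (★ FILE B2 `relIndex_normOne_eq`, CM-dressed). [cite: Kottwitz1988, §2 Thm. 2] [cite: Serre1979, Ch. V §3 Cor. 3] [cite: VignerasLNM800, Ch. II §4]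
[cite: Rogawski1990, §3.8 p. 33] -/
theorem wildAnisoTopIndex :
      ∀ (L : Type) [Field L] [NumberField L] [IsCMField L] (v : HeightOneSpectrum (𝓞 ↥(maximalRealSubfield L)))
        (w : UnitaryGroup.PlacesOver L v) (hw : IsCMField.complexConj L • w.1 = w.1),
        v.asIdeal.ramificationIdx' w.1.asIdeal ≠ 1 → (2 : 𝓞 ↥(maximalRealSubfield L)) ∈ v.asIdeal →
        ∀ (d : ℕ), (∀ τ : w.1.adicCompletion L, Valued.v τ = WithZero.exp (-1 : ℤ) →
          Valued.v (galAdicCompletionMap (L := L) (IsCMField.complexConj L) hw τ - τ) = WithZero.exp (-(d : ℤ))) →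
        ∀ (ξ : L), IsCMField.complexConj L ξ = ξ → Valued.v (algebraMap L (w.1.adicCompletion L) ξ) = 1 →
        (¬ ∃ t : w.1.adicCompletion L, t * galAdicCompletionMap (L := L) (IsCMField.complexConj L) hw t = algebraMap L (w.1.adicCompletion L) ξ) →
        ∀ (S : Subgroup ((UnitaryGroup.cmDatum L 2 !![(1 : L), 0; 0, -ξ]).Local v)),
        (∀ g : (UnitaryGroup.cmDatum L 2 !![(1 : L), 0; 0, -ξ]).Local v, g ∈ S ↔
          (((localNonsplitEquiv (IsCMField.complexConj L) !![(1 : L), 0; 0, -ξ] (IsCMField.complexConj_ne_one L) w hw g :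
              ↥(unitaryGroupOfForm (galAdicCompletionMap (L := L) (IsCMField.complexConj L) hw) (placeForm !![(1 : L), 0; 0, -ξ] w.1))) :
            GL (Fin 2) (w.1.adicCompletion L)) : Matrix (Fin 2) (Fin 2) (w.1.adicCompletion L)).det = 1) →
        (S ⊓ cmLocalIntegralLevel L 2 !![(1 : L), 0; 0, -ξ] v).relIndex S =
          (Nat.card (𝓞 ↥(maximalRealSubfield L) ⧸ v.asIdeal) + 1) * Nat.card (𝓞 ↥(maximalRealSubfield L) ⧸ v.asIdeal) ^ (d - 2) := by
  intro L _ _ _ v w hw he h2 d hd ξ hξc hξ1 hξN S hS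
  haveI : Algebra.IsQuadraticExtension ↥(maximalRealSubfield L) L := IsCMField.isQuadraticExtension L
  haveI : Finite 𝓀[w.1.adicCompletion L] := finite_residueField_adicCompletion L w.1
  have hc1 : IsCMField.complexConj L ≠ 1 := IsCMField.complexConj_ne_one L
  -- the datum at `w` in the `hd` currency, wildness, `σ_w ξ_w = ξ_w`
  obtain ⟨ϖ, hϖ⟩ := exists_valued_eq_exp_neg_one L v w
  obtain ⟨t, hD⟩ := exists_isRamifiedQuadraticDatum_of_hd L v w hw he hd hϖ
  have hσ : ∀ x : w.1.adicCompletion L, galAdicCompletionMap (L := L) (IsCMField.complexConj L) hw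
      (galAdicCompletionMap (L := L) (IsCMField.complexConj L) hw x) = x := hD.1
  have hvσ : ∀ x : w.1.adicCompletion L, Valued.v (galAdicCompletionMap (L := L) (IsCMField.complexConj L) hw x) = Valued.v x := hD.2.1
  have h2v := valued_two_lt_one_of_two_mem L v w h2
  have hσξ := galAdicCompletionMap_algebraMap_of_complexConj_eq L v w hw hξc
  -- `D¹`, `Λ¹` inside `GL₂(L_w)` and the one-field count
  obtain ⟨⟨SU, hSU⟩, ⟨SK, hSK⟩⟩ := exists_normOneGroups hσ hvσ hσξ hξ1
  have hcount := relIndex_normOne_eq hD h2v hσξ hξ1 hξN SU SK hSU hSK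
  -- the injective hom `E = subtype ∘ localNonsplitEquiv`
  set E' := localNonsplitEquiv (IsCMField.complexConj L) !![(1 : L), 0; 0, -ξ] hc1 w hw with hE'
  set E : (UnitaryGroup.cmDatum L 2 !![(1 : L), 0; 0, -ξ]).Local v →* GL (Fin 2) (w.1.adicCompletion L) :=
    (Subgroup.subtype _).comp E'.toMulEquiv.toMonoidHom with hE
  have hEg : ∀ g, E g = ((E' g : ↥(unitaryGroupOfForm (galAdicCompletionMap (L := L) (IsCMField.complexConj L) hw) (placeForm !![(1 : L), 0; 0, -ξ] w.1))) :
      GL (Fin 2) (w.1.adicCompletion L)) := fun g => rfl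
  have hEinj : Function.Injective E := fun a b h => E'.injective (Subtype.ext (by rw [← hEg, ← hEg]; exact h))
  have hP := placeForm_anisoPlane L v w ξ
  have hmem : ∀ g, ((E' g : ↥(unitaryGroupOfForm (galAdicCompletionMap (L := L) (IsCMField.complexConj L) hw) (placeForm !![(1 : L), 0; 0, -ξ] w.1))) :
      GL (Fin 2) (w.1.adicCompletion L)) ∈ unitaryGroupOfForm (galAdicCompletionMap (L := L) (IsCMField.complexConj L) hw)
        !![(1 : w.1.adicCompletion L), 0; 0, -(algebraMap L (w.1.adicCompletion L) ξ)] := fun g => by rw [← hP]; exact (E' g).2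
  have hdict := mem_unitaryGroupOfForm_and_det_eq_one_iff (galAdicCompletionMap (L := L) (IsCMField.complexConj L) hw) (algebraMap L (w.1.adicCompletion L) ξ) hσ hσξ
  -- `E(S) = D¹`
  have hmapS : S.map E = SU := by
    ext G
    rw [Subgroup.mem_map, hSU G]
    constructor
    · rintro ⟨g, hg, rfl⟩
      exact (hdict _).1 ⟨hmem g, (hS g).1 hg⟩
    · rintro ⟨a, b, hq, hN⟩
      obtain ⟨hU, hdet⟩ := (hdict G).2 ⟨a, b, hq, hN⟩
      have hU' : G ∈ unitaryGroupOfForm (galAdicCompletionMap (L := L) (IsCMField.complexConj L) hw) (placeForm !![(1 : L), 0; 0, -ξ] w.1) := by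
        rw [hP]; exact hU
      refine ⟨E'.symm ⟨G, hU'⟩, (hS _).2 ?_, ?_⟩
      · rw [ContinuousMulEquiv.apply_symm_apply]; exact hdet
      · rw [hEg, ContinuousMulEquiv.apply_symm_apply]
  -- `E(S ∩ K_an) = Λ¹`
  have hmapSK : (S ⊓ cmLocalIntegralLevel L 2 !![(1 : L), 0; 0, -ξ] v).map E = SK := by
    ext G
    rw [Subgroup.mem_map, hSK G]
    constructor
    · rintro ⟨g, hg, rfl⟩
      obtain ⟨hgS, hgK⟩ := Subgroup.mem_inf.1 hg
      obtain ⟨a, b, hq, hN⟩ := (hdict _).1 ⟨hmem g, (hS g).1 hgS⟩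
      have hint := ((mem_glInt_iff_forall_v_le_one_and_v_det_eq_one _).1
        ((mem_localIntegralLevel_iff_of_smul_eq (IsCMField.complexConj L) 2 !![(1 : L), 0; 0, -ξ] hc1 w hw g).1 hgK)).1
      refine ⟨a, b, hq, hN, ?_, ?_⟩
      · have h00 := hint 0 0
        rw [hq] at h00
        simpa using h00
      · have h10 := hint 1 0
        rw [hq] at h10
        simpa [hvσ] using h10
    · rintro ⟨a, b, hq, hN, ha, hb⟩
      obtain ⟨hU, hdet⟩ := (hdict G).2 ⟨a, b, hq, hN⟩
      have hU' : G ∈ unitaryGroupOfForm (galAdicCompletionMap (L := L) (IsCMField.complexConj L) hw) (placeForm !![(1 : L), 0; 0, -ξ] w.1) := by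
        rw [hP]; exact hU
      refine ⟨E'.symm ⟨G, hU'⟩, Subgroup.mem_inf.2 ⟨(hS _).2 ?_, (mem_localIntegralLevel_iff_of_smul_eq (IsCMField.complexConj L) 2 !![(1 : L), 0; 0, -ξ] hc1 w hw _).2 ?_⟩, ?_⟩
      · rw [ContinuousMulEquiv.apply_symm_apply]; exact hdet
      · rw [ContinuousMulEquiv.apply_symm_apply]
        refine (mem_glInt_iff_forall_v_le_one_and_v_det_eq_one G).2 ⟨fun i j => ?_, by rw [hdet, map_one]⟩
        rw [hq]
        fin_cases i <;> fin_cases j <;> simp [hξ1, hvσ, ha, hb]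
      · rw [hEg, ContinuousMulEquiv.apply_symm_apply]
  -- transport and read the residue cardinal at `v`
  have hq : Nat.card 𝓀[w.1.adicCompletion L] = Nat.card (𝓞 ↥(maximalRealSubfield L) ⧸ v.asIdeal) := by
    rw [← natCard_residueField_eq_of_compatible]
    exact natCard_residueField_eq_of_ramified (IsCMField.complexConj L) v hc1 w hw he
  rw [← Subgroup.relIndex_map_map_of_injective (S ⊓ cmLocalIntegralLevel L 2 !![(1 : L), 0; 0, -ξ] v) S hEinj, hmapSK, hmapS, hcount, hq]

end Summit.HodgeConjecture.HodgeConjecture.Cruxes.H413.K2E3WildAnisotropicPlaneTopIndex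

end
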